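import Literature.NumberTheory.PAdicHodge.DeRhamInducedRepresentation
import Literature.NumberTheory.PAdicHodge.DeRhamBaseChangeProofs
import Literature.NumberTheory.GaloisRepresentations.CliffordConstituentGeometric
import HarnessLib

/-!
# Discharge of the named fact `isDeRhamFramed_of_isDeRhamFramed_induce` (Patrikis 2019, Lemma 7.2.1)

Sibling proof file of `Literature/NumberTheory/PAdicHodge/DeRhamInducedRepresentation.lean`
(D-0014): it proves

* `isDeRhamFramed_of_isDeRhamFramed_induce_holds : isDeRhamFramed_of_isDeRhamFramed_induce` —
  for a number field `K` of degree `d`, a prime `ℓ` and a framed `θ : Γ_K →ₜ* GL_n(ℚ̄_ℓ)`, if the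
  induced representation `Ind_{Γ_K}^{Γ_ℚ} θ` (`FramedGaloisRep.induce`) is de Rham at every place
  `v ∣ ℓ` of `ℚ` for Fontaine's PINNED datum `fontainePstAdicCompletion v ℓ hv`, then `θ` is de Rham
  at every place `w ∣ ℓ` of `K` for `fontainePstAdicCompletion w ℓ hw`.

## The printed statement and proof

Patrikis, *Variations on a theorem of Tate*, Lemma 7.2.1 (§7.2; arXiv:1207.6724 p. 38): "Let
`L/K/ℚ_ℓ` be finite, and let `W` be a de Rham representation of `Γ_L`. Then `V = Ind_L^K W` is also
de Rham, and `D_dR(V)` is the image under the forgetful functor `Fil_L → Fil_K` of `D_dR(W)` […]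
Comparing dimensions, it is clear that `V` is de Rham if and only if `W` is."  The printed proof is
Frobenius reciprocity for the contravariant functor,
`D_dR^*(V) = Hom_{Γ_K}(V, B_dR) ≅ Hom_{Γ_L}(W, B_dR|_{Γ_L}) = D_dR^*(W)`.  The vendored fact is the
direction "`V` de Rham ⇒ `W` de Rham", globalised over `ℚ`.

## The tree proof (same mathematics, phrased with what the tree has)

The tree has neither `D_dR^*` nor Frobenius reciprocity for `B_dR`-admissibility, but it has the
two ingredients that the "⇐" direction amounts to:

1. **Base change** (Brinon–Conrad Prop. 6.3.8, the tree's `DeRhamBaseChange_holds`, file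
   `DeRhamBaseChangeProofs`, globalised place by place in `ToLocalRestrictField`): if `Ind θ` is de
   Rham at every `v ∣ ℓ` of `ℚ`, then the restriction `(Ind θ)|_{Γ_K}` (`restrictField`) is de Rham
   at every `w ∣ ℓ` of `K` (`isDeRhamFramed_toLocal_restrictField`).
2. **Mackey at the trivial double coset** (Serre, *Linear representations*, §7.3 Prop. 22; here
   WITHOUT normality of `res(Γ_K) ≤ Γ_ℚ`): in the matrix form `Ind(θ)(g) = (θ̇(rᵢ⁻¹ g rⱼ))ᵢⱼ`, for
   `g = res σ`, `σ ∈ Γ_K`, the block row and the block column of the index `i₀` of the trivial coset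
   (`r_{i₀}⁻¹ = res σ₁`) vanish off the diagonal, and the diagonal block is
   `θ(σ₁ σ σ₁⁻¹) = (θ(σ₁) θ θ(σ₁)⁻¹)(σ)` (`indMatrix_apply_map_row_eq_zero`,
   `indMatrix_apply_map_col_eq_zero`, `indMatrix_apply_map_diag_eq`).  Moving block `i₀` first
   (`exists_blockSplitEquiv`) presents `(Ind θ)|_{Γ_K}` as block upper triangular with corner the
   change of frame `θ(σ₁) θ θ(σ₁)⁻¹` (`exists_induce_restrictField_eq_reindex_fromBlocks`; the
   complementary corner is a framed representation by `FramedRep.exists_eq_reindex_fromBlocks`) —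
   i.e. `W ⊆ (Ind W)|_{Γ_L}` is a sub-object, the unit of the Frobenius adjunction.
3. **Heredity** (Fontaine, Exp. III Prop. 1.5.2: sub-objects of `B`-admissible representations are
   `B`-admissible; the tree's `PstWeilDeligneData.isDeRhamFramed_blocks`, file
   `PstWeilDeligneHeredity`): the corner of a de Rham block-triangular representation is de Rham,
   and de Rham-ness does not see the frame (`isDeRhamFramed_conj_iff`).

This is the argument of the accepted `isUnramifiedAt_and_isDeRhamFramed_of_conj_eq_reindex_induce`
(`CliffordConstituentGeometric`, Galois case) with the normality hypothesis removed: only the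
trivial double coset of Mackey's formula is used.

## What is NOT here

* The converse ("`W` de Rham ⇒ `Ind W` de Rham", the accepted schema `IsDeRhamFramedInduceSchema`)
  and the filtered statement `D_dR(Ind W) = forget D_dR(W)`; no definition, no new named fact,
  no `sorry`.

## References

* [Patrikis2019] S. Patrikis, *Variations on a theorem of Tate*, Mem. Amer. Math. Soc. 258 (2019),
  no. 1238 (arXiv:1207.6724): §7.2 Lemma 7.2.1 (p. 38 of the arXiv text).
* [BrinonConrad2009] O. Brinon, B. Conrad, *CMI Summer School notes on p-adic Hodge theory*
  (2009), Thm. 5.2.1, Prop. 6.3.8.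
* [FontaineAsterisque223III] J.-M. Fontaine, *Représentations p-adiques semi-stables*, Astérisque
  223 (1994), Exp. III Prop. 1.5.2.
* [SerreLinearRepresentations1977] J.-P. Serre, *Linear representations of finite groups*, GTM 42
  (1977), §3.3 (matrix form of `Ind`), §7.3 Prop. 22 (Mackey).
* [SerreAbelianLadic1968] J.-P. Serre, *Abelian ℓ-adic representations and elliptic curves* (1968),
  Ch. I §2.1 (restriction to decomposition groups).
-/

noncomputable section

open scoped NumberField
open NumberField IsDedekindDomain Field
open Literature.NumberTheory.PAdicHodge

namespace Literature.NumberTheory.GaloisRepresentations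

/-! ### §1 Mackey at the trivial coset, without normality (block matrix level) -/

section IndMatrix

variable {H G R : Type*} [Group H] [Group G] {ι : Type*}

/-- For a transversal `r` of `G / φ(H)` and the index `i₀` of the trivial coset (`r i₀ ∈ φ(H)`),
a representative `r i` lies in `φ(H)` iff `i = i₀`. [folklore] -/
theorem mem_range_iff_eq_of_transversal (φ : H →* G) {r : ι → G}
    (hr : Function.Injective fun i => (r i : G ⧸ φ.range)) {i₀ : ι} (hi₀ : r i₀ ∈ φ.range)
    (i : ι) : r i ∈ φ.range ↔ i = i₀ := by
  refine ⟨fun hi => hr ?_, fun h => h ▸ hi₀⟩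
  change (r i : G ⧸ φ.range) = (r i₀ : G ⧸ φ.range)
  rw [QuotientGroup.eq]
  exact φ.range.mul_mem (φ.range.inv_mem hi) hi₀

/-- **Mackey at the trivial coset, block row**: for `h ∈ H` the block row `i₀` (trivial coset) of
`Ind(π)(φ h) = (π̇(rᵢ⁻¹ φ(h) rⱼ))ᵢⱼ` vanishes off the diagonal — `r_{i₀}⁻¹ φ(h) rⱼ ∈ φ(H)` forces
`rⱼ ∈ φ(H)`, i.e. `j = i₀`.  No normality of `φ(H)` is needed.
Ref: Serre, *Linear representations of finite groups*, §7.3 Prop. 22 (the double coset `H·1·H`).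
[cite: SerreLinearRepresentations1977, §7.3 Prop. 22] -/
theorem indMatrix_apply_map_row_eq_zero [Zero R] (φ : H →* G) (π : H → R) {r : ι → G}
    (hr : Function.Injective fun i => (r i : G ⧸ φ.range)) {i₀ : ι} (hi₀ : r i₀ ∈ φ.range)
    (h : H) {j : ι} (hj : j ≠ i₀) : indMatrix φ π r (φ h) i₀ j = 0 := by
  rw [indMatrix_apply]
  refine dotExtend_of_not_mem φ π fun hmem =>
    hj ((mem_range_iff_eq_of_transversal φ hr hi₀ j).1 ?_)
  rwa [Subgroup.mul_mem_cancel_left _ (φ.range.mul_mem (φ.range.inv_mem hi₀) ⟨h, rfl⟩)] at hmem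

/-- **Mackey at the trivial coset, block column**: for `h ∈ H` the block column `i₀` of
`Ind(π)(φ h)` vanishes off the diagonal — `rᵢ⁻¹ φ(h) r_{i₀} ∈ φ(H)` forces `rᵢ ∈ φ(H)`.
Ref: Serre, *Linear representations of finite groups*, §7.3 Prop. 22.
[cite: SerreLinearRepresentations1977, §7.3 Prop. 22] -/
theorem indMatrix_apply_map_col_eq_zero [Zero R] (φ : H →* G) (π : H → R) {r : ι → G}
    (hr : Function.Injective fun i => (r i : G ⧸ φ.range)) {i₀ : ι} (hi₀ : r i₀ ∈ φ.range)
    (h : H) {i : ι} (hi : i ≠ i₀) : indMatrix φ π r (φ h) i i₀ = 0 := by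
  rw [indMatrix_apply]
  refine dotExtend_of_not_mem φ π fun hmem =>
    hi ((mem_range_iff_eq_of_transversal φ hr hi₀ i).1 ?_)
  rw [mul_assoc, Subgroup.mul_mem_cancel_right _ (φ.range.mul_mem ⟨h, rfl⟩ hi₀), inv_mem_iff] at hmem
  exact hmem

/-- **Mackey at the trivial coset, diagonal block**: if `φ t₀ = r_{i₀}⁻¹` then the diagonal block
`i₀` of `Ind(π)(φ h)` is `π̇(r_{i₀}⁻¹ φ(h) r_{i₀}) = π(t₀ h t₀⁻¹)`, the conjugate representation.
Ref: Serre, *Linear representations of finite groups*, §7.3 Prop. 22.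
[cite: SerreLinearRepresentations1977, §7.3 Prop. 22] -/
theorem indMatrix_apply_map_diag_eq [Zero R] {φ : H →* G} (hφ : Function.Injective φ)
    (π : H → R) (r : ι → G) {i₀ : ι} {t₀ : H} (ht₀ : φ t₀ = (r i₀)⁻¹) (h : H) :
    indMatrix φ π r (φ h) i₀ i₀ = π (t₀ * h * t₀⁻¹) := by
  have hconj : (r i₀)⁻¹ * φ h * r i₀ = φ (t₀ * h * t₀⁻¹) := by
    rw [map_mul, map_mul, map_inv, ht₀, inv_inv]
  rw [indMatrix_apply, hconj, dotExtend_apply_map hφ]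

end IndMatrix

/-! ### §2 `(Ind_{Γ_F}^{Γ_K} ρ)|_{Γ_F}` is block upper triangular with corner a conjugate of `ρ` -/

section Galois

variable (K F : Type) [Field K] [NumberField K] [Field F] [NumberField F] [Algebra K F] {d : ℕ}

/-- **`ρ` is a sub-object of `(Ind_{Γ_F}^{Γ_K} ρ)|_{Γ_F}`, in coordinates, for an ARBITRARY finite
extension of number fields `F/K`** (the unit of Frobenius reciprocity; Mackey's formula at the
trivial double coset): there are `σ₁ ∈ Γ_F` (with `res σ₁ = r_{i₀}⁻¹` for the trivial coset `i₀`),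
`q`, a relabelling `E : Fin n ⊕ Fin q ≃ Fin (d n)` and a framed `D : Γ_F →ₜ* GL_q(A)` such that
`Ind(ρ)(res σ) = E·(ρ(σ₁) ρ(σ) ρ(σ₁)⁻¹  B(σ); 0  D(σ))·E⁻¹` for every `σ ∈ Γ_F` (in fact `B = 0`).
This is the accepted `exists_restrictField_eq_reindex_fromBlocks_outerConj`
(`CliffordConstituentGeometric`) without the hypothesis "`F/K` Galois": only the block row and
column of the trivial coset are used (`indMatrix_apply_map_row_eq_zero`, `_col_eq_zero`,
`_diag_eq`), then block `i₀` is moved first (`exists_blockSplitEquiv`) and the complementary corner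
is a framed representation (`FramedRep.exists_eq_reindex_fromBlocks`).
[cite: SerreLinearRepresentations1977, §7.3 Prop. 22] [cite: SerreAbelianLadic1968, Ch. I §2.1] -/
theorem exists_induce_restrictField_eq_reindex_fromBlocks (hd : Module.finrank K F = d)
    {A : Type*} [CommRing A] [TopologicalSpace A] [IsTopologicalRing A] {n : ℕ}
    (ρ : FramedGaloisRep F A n) :
    ∃ (σ₁ : absoluteGaloisGroup F) (q : ℕ) (E : Fin n ⊕ Fin q ≃ Fin (d * n))
      (D : FramedGaloisRep F A q),
      ∀ σ : absoluteGaloisGroup F, ∃ B : Matrix (Fin n) (Fin q) A,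
        (((ρ.induce K hd).restrictField F σ : GL (Fin (d * n)) A) :
            Matrix (Fin (d * n)) (Fin (d * n)) A) =
          Matrix.reindex E E (Matrix.fromBlocks
            ((FramedRep.conj (ρ σ₁) ρ σ : GL (Fin n) A) : Matrix (Fin n) (Fin n) A) B 0
            ((D σ : GL (Fin q) A) : Matrix (Fin q) (Fin q) A)) := by
  -- the index `i₀` of the trivial coset and `σ₁` with `res σ₁ = r_{i₀}⁻¹`
  obtain ⟨i₀, hi₀⟩ := (absGaloisCosetRep_bijective K F hd).2
    ((1 : absoluteGaloisGroup K) : absoluteGaloisGroup K ⧸ (absGaloisRestrict K F).range)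
  have hri₀ : absGaloisCosetRep K F hd i₀ ∈ (absGaloisRestrict K F).range := by
    have h := QuotientGroup.eq.1 hi₀
    rwa [mul_one, inv_mem_iff] at h
  obtain ⟨σ₁, hσ₁⟩ : (absGaloisCosetRep K F hd i₀)⁻¹ ∈ (absGaloisRestrict K F).range :=
    inv_mem hri₀
  -- the relabelling moving block `i₀` first
  let q : ℕ := Fintype.card ({i : Fin d // i ≠ i₀} × Fin n)
  let e' : ({i : Fin d // i ≠ i₀} × Fin n) ≃ Fin q := Fintype.equivFin _
  obtain ⟨E₁, hE₁l, hE₁r⟩ := exists_blockSplitEquiv i₀ (Fin n)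
  let E₀ : Fin n ⊕ Fin q ≃ Fin d × Fin n := (Equiv.sumCongr (Equiv.refl (Fin n)) e'.symm).trans E₁
  let E : Fin n ⊕ Fin q ≃ Fin (d * n) := E₀.trans finProdFinEquiv
  -- the entries of `Ind(ρ)(res σ)` in the relabelling `E`
  have hentry : ∀ (σ : absoluteGaloisGroup F) (x y : Fin n ⊕ Fin q),
      (((ρ.induce K hd).restrictField F σ : GL (Fin (d * n)) A) :
          Matrix (Fin (d * n)) (Fin (d * n)) A) (E x) (E y) =
        indMatrix (absGaloisRestrict K F).toMonoidHom (FramedRep.toMatrixHom ρ)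
          (absGaloisCosetRep K F hd) ((absGaloisRestrict K F).toMonoidHom σ)
          (E₀ x).1 (E₀ y).1 (E₀ x).2 (E₀ y).2 := by
    intro σ x y
    rw [FramedGaloisRep.restrictField_apply, FramedGaloisRep.induce_apply_coe_apply,
      indMatrix_apply]
    simp only [E, Equiv.trans_apply, Equiv.symm_apply_apply]
    rfl
  have hl : ∀ a : Fin n, E₀ (Sum.inl a) = (i₀, a) := fun a => by simp [E₀, hE₁l]
  have hr2 : ∀ c : Fin q, (E₀ (Sum.inr c)).1 ≠ i₀ := fun c => by
    simpa [E₀, hE₁r] using (e'.symm c).1.2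
  -- the lower-left block vanishes (block column `i₀`)
  have h21 : ∀ σ : absoluteGaloisGroup F, Matrix.toBlocks₂₁
      ((((ρ.induce K hd).restrictField F σ : GL (Fin (d * n)) A) :
        Matrix (Fin (d * n)) (Fin (d * n)) A).submatrix E E) = 0 := by
    intro σ
    ext c b
    simp only [Matrix.toBlocks₂₁, Matrix.of_apply, Matrix.submatrix_apply, Matrix.zero_apply]
    rw [hentry, hl b]
    dsimp only
    rw [indMatrix_apply_map_col_eq_zero _ _ (absGaloisCosetRep_bijective K F hd).1 hri₀ σ (hr2 c),
      Matrix.zero_apply]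
  -- the upper-left block is the conjugate `ρ(σ₁) ρ ρ(σ₁)⁻¹`
  have h11 : ∀ σ : absoluteGaloisGroup F, Matrix.toBlocks₁₁
      ((((ρ.induce K hd).restrictField F σ : GL (Fin (d * n)) A) :
        Matrix (Fin (d * n)) (Fin (d * n)) A).submatrix E E) =
        ((FramedRep.conj (ρ σ₁) ρ σ : GL (Fin n) A) : Matrix (Fin n) (Fin n) A) := by
    intro σ
    ext a b
    simp only [Matrix.toBlocks₁₁, Matrix.of_apply, Matrix.submatrix_apply]
    rw [hentry, hl a, hl b]
    dsimp only
    rw [indMatrix_apply_map_diag_eq (absGaloisRestrict_injective K F) _ _ hσ₁ σ,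
      FramedRep.toMatrixHom_apply, FramedRep.conj_apply, map_mul, map_mul, map_inv]
  obtain ⟨D, hD⟩ := FramedRep.exists_eq_reindex_fromBlocks ((ρ.induce K hd).restrictField F) E h21
  refine ⟨σ₁, q, E, D, fun σ =>
    ⟨Matrix.toBlocks₁₂ ((((ρ.induce K hd).restrictField F σ : GL (Fin (d * n)) A) :
      Matrix (Fin (d * n)) (Fin (d * n)) A).submatrix E E), ?_⟩⟩
  have h := hD σ
  rwa [h11 σ] at h

end Galois

end Literature.NumberTheory.GaloisRepresentations

/-! ### §3 The discharge -/

namespace Literature.NumberTheory.PAdicHodge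

open Literature.NumberTheory.GaloisRepresentations

/-- **`isDeRhamFramed_of_isDeRhamFramed_induce` holds** (Patrikis 2019, Lemma 7.2.1, direction
"`Ind W` de Rham ⇒ `W` de Rham", globalised over `ℚ`; for THE pinned Fontaine data): for a number
field `K` of degree `d`, a prime `ℓ` and a framed `θ : Γ_K →ₜ* GL_n(ℚ̄_ℓ)`, if `Ind_{Γ_K}^{Γ_ℚ} θ`
is de Rham at every `v ∣ ℓ` of `ℚ` then `θ` is de Rham at every `w ∣ ℓ` of `K`.  Proof:
`(Ind θ)|_{Γ_K}` is de Rham at every `w ∣ ℓ` (base change, Brinon–Conrad Prop. 6.3.8: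
`isDeRhamFramed_toLocal_restrictField DeRhamBaseChange_holds`); it is block upper triangular with
corner `θ(σ₁) θ θ(σ₁)⁻¹` (Mackey at the trivial coset, `exists_induce_restrictField_eq_reindex_fromBlocks`),
and so is its localisation at `w` (restriction along `Γ_{K_w} → Γ_K` is entrywise); the corner of a
de Rham block-triangular representation is de Rham (Fontaine Exp. III Prop. 1.5.2,
`PstWeilDeligneData.isDeRhamFramed_blocks`), and de Rham-ness does not see the frame
(`toLocal_conj`, `isDeRhamFramed_conj_iff`).
[cite: Patrikis2019, Lemma 7.2.1 (§7.2; arXiv:1207.6724 p. 38)]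
[cite: BrinonConrad2009, Prop. 6.3.8] [cite: FontaineAsterisque223III, Exp. III Prop. 1.5.2]
[cite: SerreLinearRepresentations1977, §7.3 Prop. 22] -/
theorem isDeRhamFramed_of_isDeRhamFramed_induce_holds :
    isDeRhamFramed_of_isDeRhamFramed_induce := by
  intro K _ _ d hd ℓ _ n θ hInd w hw
  -- (1) base change: `(Ind θ)|_{Γ_K}` is de Rham at `w`
  have hR : (fontainePstAdicCompletion w ℓ hw).IsDeRhamFramed
      (((θ.induce ℚ hd).restrictField K).toLocal w) :=
    isDeRhamFramed_toLocal_restrictField DeRhamBaseChange_holds (θ.induce ℚ hd) hInd w hw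
  -- (2) Mackey at the trivial coset: block upper triangular with corner `θ(σ₁) θ θ(σ₁)⁻¹`
  obtain ⟨σ₁, q, E, D, hblock⟩ := exists_induce_restrictField_eq_reindex_fromBlocks ℚ K hd θ
  have hT : ∀ g : absoluteGaloisGroup (w.adicCompletion K),
      ∃ B : Matrix (Fin n) (Fin q) (PadicAlgCl ℓ),
        ((((θ.induce ℚ hd).restrictField K).toLocal w g : GL (Fin (d * n)) (PadicAlgCl ℓ)) :
            Matrix (Fin (d * n)) (Fin (d * n)) (PadicAlgCl ℓ)) =
          Matrix.reindex E E (Matrix.fromBlocks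
            (((FramedGaloisRep.toLocal w (FramedRep.conj (θ σ₁) θ)) g :
              GL (Fin n) (PadicAlgCl ℓ)) : Matrix (Fin n) (Fin n) (PadicAlgCl ℓ)) B 0
            ((D.toLocal w g : GL (Fin q) (PadicAlgCl ℓ)) :
              Matrix (Fin q) (Fin q) (PadicAlgCl ℓ))) :=
    fun g => hblock _
  -- (3) heredity and frame invariance
  have hA := ((fontainePstAdicCompletion w ℓ hw).isDeRhamFramed_blocks E hT hR).1
  rwa [FramedGaloisRep.toLocal_conj, PstWeilDeligneData.isDeRhamFramed_conj_iff] at hA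

end Literature.NumberTheory.PAdicHodge

end
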